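import Summits.CriticalPhenomena.CardyFormulaZ2.Theorems.CardyGluingRDEJunctionShadowingRecord
import Literature.Probability.Percolation.CrossingChains
import Literature.Probability.Percolation.RSWProofs
import Literature.Probability.Percolation.FourArmGarbanSquareDomain
import Literature.Probability.LatticeModels.MeshDomainBulk

/-!
# Refutation of `CardyGluingRDE.JunctionShadowing` (stmt-CriticalPhenomena-8581)

The crux bounds, for all small meshes `u`, the probability that the "glued" connectivity of the
`6·2^r` coarse boundary segments of the domino `Ω = (0,2δ₀) × (0,δ₀)` (equivalence closure of the
`discreteCrossing` relations inside the squares `Ω_L`, `Ω_R` through the `2^j` seam arcs) differs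
from the true `discreteCrossing` connectivity in `Ω`, by `C·2^{-ε(j-r)}`. It is FALSE AS TYPED
[refuted-misstated]: `discreteArc Ω δ A` compares distances with `≤`, so a boundary vertex
equidistant from two nodes lies in BOTH discrete arcs and `discreteCrossing` holds there by the
trivial path, for every configuration. At `δ₀ = 1`, `r = 0`, `u = 1/N` (`N ≥ max (2, 2^j)`) the
corner vertices `(1,1)`, `(N-1,1)`, `(N+1,1)`, `(2N-1,1)` glue left side ~ bottom of `Ω_L` ~ seam
arc 0 ~ bottom of `Ω_R` ~ right side deterministically, while the truth "left side ↔ right side in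
`Ω_{1/N}`" is contained in a long-way lattice box crossing of probability `≤ h(N-1,N-2) = 1/2`
(self-duality, Grimmett 1999 Lemma 11.21; tree: `crossingProb_half_succ_self_holds`,
`crossingProb_anti_left`). So `P(Err) ≥ 1/2` at all these meshes. Repair: STRICT discrete arcs
(see the theorem's docstring). Crux attack 2026-08-15, refuter-rattack-stmt-CriticalPhenomena-8581-0
(paper witness first recorded by refuter-rreview-0815T13-1-0). All auxiliaries are private.
-/

namespace Summit.CriticalPhenomena.CardyFormulaZ2.Theorems

open Set Metric MeasureTheory Complex
open Literature.Probability.Percolation Literature.Probability.LatticeModels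

/-- Mirror of the statement's `ΩL` (left open square). [folklore] -/
private def domL : ℝ → Set ℂ := fun δ₀ => {z : ℂ | 0 < z.re ∧ z.re < δ₀ ∧ 0 < z.im ∧ z.im < δ₀}
/-- Mirror of the statement's `ΩR` (right open square). [folklore] -/
private def domR : ℝ → Set ℂ := fun δ₀ => {z : ℂ | δ₀ < z.re ∧ z.re < 2 * δ₀ ∧ 0 < z.im ∧ z.im < δ₀}
/-- Mirror of the statement's `Ω` (the open domino). [folklore] -/
private def dom : ℝ → Set ℂ := fun δ₀ => {z : ℂ | 0 < z.re ∧ z.re < 2 * δ₀ ∧ 0 < z.im ∧ z.im < δ₀}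
/-- Mirror of the statement's `outer` (the `6·2^r` coarse boundary segments). [folklore] -/
private def outer : (δ₀ : ℝ) → (r : ℕ) → Fin 6 × Fin (2 ^ r) → Set ℂ := fun δ₀ r a => {z : ℂ | (a.1 = 0 ∧ z.im = 0 ∧ δ₀ * ((a.2 : ℕ) : ℝ) / 2 ^ r ≤ z.re ∧ z.re ≤ δ₀ * (((a.2 : ℕ) : ℝ) + 1) / 2 ^ r) ∨ (a.1 = 1 ∧ z.im = 0 ∧ δ₀ + δ₀ * ((a.2 : ℕ) : ℝ) / 2 ^ r ≤ z.re ∧ z.re ≤ δ₀ + δ₀ * (((a.2 : ℕ) : ℝ) + 1) / 2 ^ r) ∨ (a.1 = 2 ∧ z.re = 2 * δ₀ ∧ δ₀ * ((a.2 : ℕ) : ℝ) / 2 ^ r ≤ z.im ∧ z.im ≤ δ₀ * (((a.2 : ℕ) : ℝ) + 1) / 2 ^ r) ∨ (a.1 = 3 ∧ z.im = δ₀ ∧ δ₀ + δ₀ * ((a.2 : ℕ) : ℝ) / 2 ^ r ≤ z.re ∧ z.re ≤ δ₀ + δ₀ * (((a.2 : ℕ) : ℝ) + 1) / 2 ^ r)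 ∨ (a.1 = 4 ∧ z.im = δ₀ ∧ δ₀ * ((a.2 : ℕ) : ℝ) / 2 ^ r ≤ z.re ∧ z.re ≤ δ₀ * (((a.2 : ℕ) : ℝ) + 1) / 2 ^ r) ∨ (a.1 = 5 ∧ z.re = 0 ∧ δ₀ * ((a.2 : ℕ) : ℝ) / 2 ^ r ≤ z.im ∧ z.im ≤ δ₀ * (((a.2 : ℕ) : ℝ) + 1) / 2 ^ r)}
/-- Mirror of the statement's `seam` (the `2^j` seam arcs). [folklore] -/
private def seam : (δ₀ : ℝ) → (j : ℕ) → Fin (2 ^ j) → Set ℂ := fun δ₀ j t => {z : ℂ | z.re = δ₀ ∧ δ₀ * ((t : ℕ) : ℝ) / 2 ^ j ≤ z.im ∧ z.im ≤ δ₀ * (((t : ℕ) : ℝ) + 1) / 2 ^ j}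
/-- Mirror of the statement's `toSet` (node ↦ boundary piece). [folklore] -/
private def toSet : (δ₀ : ℝ) → (r j : ℕ) → (Fin 6 × Fin (2 ^ r)) ⊕ Fin (2 ^ j) → Set ℂ := fun δ₀ r j v => Sum.elim (outer δ₀ r) (seam δ₀ j) v
/-- Mirror of the statement's error event `Err` (glued ≠ truth for some coarse pair), with its
`isL`, `admL`, `admR`, `rel` inlined. [folklore] -/
private def Err : (δ₀ : ℝ) → (r j : ℕ) → ℝ → Set (BondConfig (Site 2)) := fun δ₀ r j u =>
  {ω | ∃ a b : Fin 6 × Fin (2 ^ r), ¬ (Relation.EqvGen (fun v w =>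
      (Sum.elim (fun a => a.1 = 0 ∨ a.1 = 4 ∨ a.1 = 5) (fun _ => True) v ∧
        Sum.elim (fun a => a.1 = 0 ∨ a.1 = 4 ∨ a.1 = 5) (fun _ => True) w ∧
          ω ∈ discreteCrossing (domL δ₀) u (toSet δ₀ r j v) (toSet δ₀ r j w)) ∨
      (Sum.elim (fun a => ¬ (a.1 = 0 ∨ a.1 = 4 ∨ a.1 = 5)) (fun _ => True) v ∧
        Sum.elim (fun a => ¬ (a.1 = 0 ∨ a.1 = 4 ∨ a.1 = 5)) (fun _ => True) w ∧
          ω ∈ discreteCrossing (domR δ₀) u (toSet δ₀ r j v) (toSet δ₀ r j w)))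
    (Sum.inl a) (Sum.inl b) ↔ ω ∈ discreteCrossing (dom δ₀) u (outer δ₀ r a) (outer δ₀ r b))}
/-- The route statement, unfolded through the mirror defs (definitional). [folklore] -/
private theorem iff_mirror : Summit.CriticalPhenomena.CardyFormulaZ2.Theses.CardyGluingRDE.JunctionShadowing ↔
    ∃ ε : ℝ, 0 < ε ∧ ∀ r : ℕ, ∃ C : ℝ, 0 < C ∧ ∀ j : ℕ, r ≤ j → ∀ δ₀ : ℝ, 0 < δ₀ → ∃ δ₁ : ℝ, 0 < δ₁ ∧
      ∀ u : ℝ, 0 < u → u < δ₁ → (bondPercolation (zdGraph 2) half).real (Err δ₀ r j u) ≤ C * (2 : ℝ) ^ (-(ε * ((j : ℝ) - r))) :=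
  Iff.rfl
/-- The open axis-parallel rectangle `(a,b) × (c,d)`. [folklore] -/
private def oRect (a b c d : ℝ) : Set ℂ := Ioo a b ×ℂ Ioo c d
/-- The three domains at `δ₀ = 1` as open rectangles. [folklore] -/
private theorem dom_one : domL 1 = oRect 0 1 0 1 ∧ domR 1 = oRect 1 2 0 1 ∧ dom 1 = oRect 0 2 0 1 := by
  refine ⟨?_, ?_, ?_⟩ <;> ext z <;>
    simp only [domL, domR, dom, oRect, mem_reProdIm, mem_setOf_eq, mem_Ioo] <;> norm_num <;> tauto
/-- Mesh vertices of an open rectangle, in coordinates. [folklore] -/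
private theorem mem_meshVertices_oRect {a b c d δ : ℝ} {x : Site 2} :
    x ∈ meshVertices (oRect a b c d) δ ↔ (a < δ * x 0 ∧ δ * x 0 < b) ∧ (c < δ * x 1 ∧ δ * x 1 < d) := by
  simp [oRect, mem_reProdIm]
/-- The mesh graph of an open rectangle is connected (staircase lemma), so the discrete domain is
the whole set of mesh vertices. [folklore] -/
private theorem meshDomain_oRect (a b c d : ℝ) {δ : ℝ} (hδ : 0 < δ) :
    meshDomain (oRect a b c d) δ = meshVertices (oRect a b c d) δ := by
  refine meshDomain_eq_meshVertices_of_preconnected ?_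
  rintro ⟨x, hx⟩ ⟨y, hy⟩
  refine meshVertexGraph_reachable_of_rectangle_subset hδ _ x y rfl (fun z hz => ?_) hx hy
  have hx' := mem_meshVertices_oRect.1 hx; have hy' := mem_meshVertices_oRect.1 hy
  rw [Rectangle, mem_reProdIm, meshPoint_re, meshPoint_re, meshPoint_im, meshPoint_im] at hz
  exact ⟨(ordConnected_Ioo.uIcc_subset ⟨hx'.1.1, hx'.1.2⟩ ⟨hy'.1.1, hy'.1.2⟩) hz.1,
    (ordConnected_Ioo.uIcc_subset ⟨hx'.2.1, hx'.2.2⟩ ⟨hy'.2.1, hy'.2.2⟩) hz.2⟩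
/-- Points of the bottom and top sides are frontier points. [folklore] -/
private theorem mem_frontier_oRect {a b c d : ℝ} (hab : a < b) (hcd : c < d) {z : ℂ}
    (hre : a ≤ z.re ∧ z.re ≤ b) (him : z.im = c ∨ z.im = d) : z ∈ frontier (oRect a b c d) := by
  rw [oRect, frontier_reProdIm, closure_Ioo hab.ne, frontier_Ioo hcd]
  exact Or.inl ⟨hre, by rcases him with h | h <;> simp [h]⟩
/-- Lower bound for `infDist` to a nonempty set. [folklore] -/
private theorem le_infDist_of_forall' {x : ℂ} {s : Set ℂ} {r : ℝ} (hs : s.Nonempty)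
    (h : ∀ y ∈ s, r ≤ dist x y) : r ≤ infDist x s := by
  by_contra hlt
  obtain ⟨y, hy, hxy⟩ := (infDist_lt_iff hs).1 (not_le.1 hlt)
  exact absurd hxy (not_lt.2 (h y hy))
/-- A point at sup-distance `≥ δ` inside `(a,b) × (0,1)` is at distance `≥ δ` from the frontier
(frontier points lie on the four side lines). [folklore] -/
private theorem le_dist_of_mem_frontier {a b δ : ℝ} (hab : a < b) {p : ℂ} (h1 : a + δ ≤ p.re) (h2 : p.re ≤ b - δ)
    (h3 : δ ≤ p.im) (h4 : p.im ≤ 1 - δ) : ∀ z ∈ frontier (oRect a b 0 1), δ ≤ dist p z := by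
  intro z hz
  have hre : |p.re - z.re| ≤ dist p z := by rw [dist_eq_norm]; exact abs_re_sub_le_norm_sub p z
  have him : |p.im - z.im| ≤ dist p z := by rw [dist_eq_norm]; simpa using abs_im_le_norm (p - z)
  rw [oRect, frontier_reProdIm, frontier_Ioo hab, frontier_Ioo zero_lt_one] at hz
  simp only [mem_union, mem_reProdIm, mem_insert_iff, mem_singleton_iff] at hz
  rcases hz with ⟨-, h | h⟩ | ⟨h | h, -⟩
  · exact (le_abs.2 (Or.inl (by rw [h]; linarith))).trans him
  · exact (le_abs.2 (Or.inr (by rw [h]; linarith))).trans him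
  · exact (le_abs.2 (Or.inl (by rw [h]; linarith))).trans hre
  · exact (le_abs.2 (Or.inr (by rw [h]; linarith))).trans hre
/-- The left side of the domino (`δ₀ = 1`, `r = 0`). [folklore] -/
private theorem mem_outer50 {z : ℂ} : z ∈ outer 1 0 ((5 : Fin 6), (0 : Fin (2 ^ 0))) ↔ z.re = 0 ∧ 0 ≤ z.im ∧ z.im ≤ 1 := by
  simp [outer]
/-- The bottom side of `Ω_L`. [folklore] -/
private theorem mem_outer00 {z : ℂ} : z ∈ outer 1 0 ((0 : Fin 6), (0 : Fin (2 ^ 0))) ↔ z.im = 0 ∧ 0 ≤ z.re ∧ z.re ≤ 1 := by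
  simp [outer]
/-- The bottom side of `Ω_R`. [folklore] -/
private theorem mem_outer10 {z : ℂ} : z ∈ outer 1 0 ((1 : Fin 6), (0 : Fin (2 ^ 0))) ↔ z.im = 0 ∧ 1 ≤ z.re ∧ z.re ≤ 2 := by
  simp [outer]; norm_num
/-- The right side of the domino. [folklore] -/
private theorem mem_outer20 {z : ℂ} : z ∈ outer 1 0 ((2 : Fin 6), (0 : Fin (2 ^ 0))) ↔ z.re = 2 ∧ 0 ≤ z.im ∧ z.im ≤ 1 := by
  simp [outer]
/-- The bottom seam arc. [folklore] -/
private theorem mem_seam0 {j : ℕ} {z : ℂ} : z ∈ seam 1 j 0 ↔ z.re = 1 ∧ 0 ≤ z.im ∧ z.im ≤ (2 ^ j)⁻¹ := by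
  simp [seam]
/-- **Tie criterion.** At mesh `1/N` the lattice point `(k, 1)` of `(a,b) × (0,1)`, at sup-distance
`≥ 1/N` from the frontier, lies in the discrete arcs of BOTH a node `A ∋ (s, 1/N)` with
`|k/N - s| = 1/N` (a vertical side / seam arc) and a node `B ∋ (k/N, 0)` (a bottom segment), provided
neither is the whole frontier (`discreteArc` compares with `≤`). [folklore] -/
private theorem tie_pair {a b : ℝ} (hab : a < b) {N : ℕ} (hN : 2 ≤ N) {k : ℤ} {A B : Set ℂ} {s : ℝ}
    (hk1 : a + (N : ℝ)⁻¹ ≤ (N : ℝ)⁻¹ * k) (hk2 : (N : ℝ)⁻¹ * k ≤ b - (N : ℝ)⁻¹)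
    (hA : (⟨s, (N : ℝ)⁻¹⟩ : ℂ) ∈ A) (hs : |(N : ℝ)⁻¹ * k - s| = (N : ℝ)⁻¹) (hA' : (⟨(a + b) / 2, 1⟩ : ℂ) ∉ A)
    (hB : (⟨(N : ℝ)⁻¹ * k, 0⟩ : ℂ) ∈ B) (hB' : (⟨(a + b) / 2, 1⟩ : ℂ) ∉ B) :
    (![k, 1] : Site 2) ∈ discreteArc (oRect a b 0 1) (N : ℝ)⁻¹ A ∧
      (![k, 1] : Site 2) ∈ discreteArc (oRect a b 0 1) (N : ℝ)⁻¹ B := by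
  have ht0 : (0 : ℝ) < (N : ℝ)⁻¹ := inv_pos.2 (by exact_mod_cast (show 0 < N by omega))
  have ht1 : (N : ℝ)⁻¹ ≤ 1 / 2 := by rw [one_div]; exact inv_anti₀ two_pos (by exact_mod_cast hN)
  have hmp : meshPoint (N : ℝ)⁻¹ ![k, 1] = ⟨(N : ℝ)⁻¹ * k, (N : ℝ)⁻¹⟩ := by
    apply Complex.ext <;> simp [meshPoint_re, meshPoint_im]
  have hD := meshDomain_oRect a b 0 1 ht0
  have hbd : (![k, 1] : Site 2) ∈ meshBoundary (oRect a b 0 1) (N : ℝ)⁻¹ := by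
    refine ⟨?_, ![k, 1] - Pi.single 1 1, (zdGraph_adj_iff _ _).2 ⟨1, Or.inr (sub_add_cancel _ _).symm⟩, fun h => ?_⟩
    · rw [hD, mem_meshVertices_oRect]; simp only [Matrix.cons_val_zero, Matrix.cons_val_one, Int.cast_one, mul_one]
      exact ⟨⟨by linarith, by linarith⟩, ht0, by linarith⟩
    · have h' := (discreteDomainGraph_adj_iff.1 h).2.2
      rw [hD, mem_meshVertices_oRect] at h'; simp at h'
  have hfar : ∀ C : Set ℂ, (⟨(a + b) / 2, 1⟩ : ℂ) ∉ C →
      (N : ℝ)⁻¹ ≤ infDist (meshPoint (N : ℝ)⁻¹ ![k, 1]) (frontier (oRect a b 0 1) \ C) := fun C hC => by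
    rw [hmp]
    refine le_infDist_of_forall' ⟨_, mem_frontier_oRect hab zero_lt_one ⟨by simp; linarith, by simp; linarith⟩ (Or.inr rfl), hC⟩ ?_
    exact fun z hz => le_dist_of_mem_frontier (p := ⟨(N : ℝ)⁻¹ * k, (N : ℝ)⁻¹⟩) hab hk1 hk2 (le_of_eq rfl)
      (by show (N : ℝ)⁻¹ ≤ 1 - (N : ℝ)⁻¹; linarith) z hz.1
  refine ⟨⟨hbd, le_trans ?_ (hfar A hA')⟩, ⟨hbd, le_trans ?_ (hfar B hB')⟩⟩ <;> rw [hmp]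
  · refine (infDist_le_dist_of_mem hA).trans_eq ?_
    rw [dist_of_im_eq (z := ⟨(N : ℝ)⁻¹ * k, (N : ℝ)⁻¹⟩) (w := ⟨s, (N : ℝ)⁻¹⟩) rfl, Real.dist_eq]; exact hs
  · refine (infDist_le_dist_of_mem hB).trans_eq ?_
    rw [dist_of_re_eq (z := ⟨(N : ℝ)⁻¹ * k, (N : ℝ)⁻¹⟩) (w := ⟨(N : ℝ)⁻¹ * k, 0⟩) rfl, Real.dist_eq]; simp [abs_of_pos ht0]
/-- `0 < 1/N ≤ 1/2` and `(N-1)/N`, `(N+1)/N`, `(2N-1)/N` for `N ≥ 2`. [folklore] -/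
private theorem invN_facts {N : ℕ} (hN : 2 ≤ N) : ((0 : ℝ) < (N : ℝ)⁻¹ ∧ (N : ℝ)⁻¹ ≤ 1 / 2) ∧
    (N : ℝ)⁻¹ * (((N : ℤ) - 1 : ℤ) : ℝ) = 1 - (N : ℝ)⁻¹ ∧ (N : ℝ)⁻¹ * (((N : ℤ) + 1 : ℤ) : ℝ) = 1 + (N : ℝ)⁻¹ ∧
      (N : ℝ)⁻¹ * ((2 * (N : ℤ) - 1 : ℤ) : ℝ) = 2 - (N : ℝ)⁻¹ := by
  have hN' : (N : ℝ) ≠ 0 := by exact_mod_cast (show N ≠ 0 by omega)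
  refine ⟨⟨inv_pos.2 (by positivity), by rw [one_div]; exact inv_anti₀ two_pos (by exact_mod_cast hN)⟩, ?_, ?_, ?_⟩ <;>
    push_cast <;> field_simp
/-- Tie vertex `P₁ = (1,1)`: in the discrete arcs of the left side and of the bottom side of `Ω_L`. [folklore] -/
private theorem P1_mem {N : ℕ} (hN : 2 ≤ N) :
    (![1, 1] : Site 2) ∈ discreteArc (oRect 0 1 0 1) (N : ℝ)⁻¹ (outer 1 0 ((5 : Fin 6), (0 : Fin (2 ^ 0)))) ∧
      (![1, 1] : Site 2) ∈ discreteArc (oRect 0 1 0 1) (N : ℝ)⁻¹ (outer 1 0 ((0 : Fin 6), (0 : Fin (2 ^ 0)))) := by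
  obtain ⟨⟨ht0, ht1⟩, -⟩ := invN_facts hN
  refine tie_pair zero_lt_one hN (s := 0) (by simp) (by simp; linarith) (mem_outer50.2 ⟨rfl, ht0.le, by show (N : ℝ)⁻¹ ≤ 1; linarith⟩)
    (by simp [abs_of_pos ht0]) (by rw [mem_outer50]; norm_num) (mem_outer00.2 ⟨rfl, by simp [ht0.le], by simp; linarith⟩)
    (by rw [mem_outer00]; norm_num)
/-- Tie vertex `P₂ = (N-1,1)`: in the discrete arcs of seam arc `0` and of the bottom side of `Ω_L`. [folklore] -/
private theorem P2_mem {N j : ℕ} (hN : 2 ≤ N) (hj : 2 ^ j ≤ N) :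
    (![(N : ℤ) - 1, 1] : Site 2) ∈ discreteArc (oRect 0 1 0 1) (N : ℝ)⁻¹ (seam 1 j 0) ∧
      (![(N : ℤ) - 1, 1] : Site 2) ∈ discreteArc (oRect 0 1 0 1) (N : ℝ)⁻¹ (outer 1 0 ((0 : Fin 6), (0 : Fin (2 ^ 0)))) := by
  obtain ⟨⟨ht0, ht1⟩, e, -, -⟩ := invN_facts hN
  have htj : (N : ℝ)⁻¹ ≤ (2 ^ j)⁻¹ := inv_anti₀ (by positivity) (by exact_mod_cast hj)
  refine tie_pair zero_lt_one hN (s := 1) (by rw [e]; linarith) (by rw [e]) ((mem_seam0 (j := j)).2 ⟨rfl, ht0.le, htj⟩)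
    (by rw [e, show (1 : ℝ) - (N : ℝ)⁻¹ - 1 = -(N : ℝ)⁻¹ by ring, abs_neg, abs_of_pos ht0]) (by rw [mem_seam0]; norm_num)
    (mem_outer00.2 ⟨rfl, by show (0 : ℝ) ≤ (N : ℝ)⁻¹ * (((N : ℤ) - 1 : ℤ) : ℝ); rw [e]; linarith,
      by show (N : ℝ)⁻¹ * (((N : ℤ) - 1 : ℤ) : ℝ) ≤ 1; rw [e]; linarith⟩) (by rw [mem_outer00]; norm_num)
/-- Tie vertex `P₃ = (N+1,1)`: in the discrete arcs of seam arc `0` and of the bottom side of `Ω_R`. [folklore] -/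
private theorem P3_mem {N j : ℕ} (hN : 2 ≤ N) (hj : 2 ^ j ≤ N) :
    (![(N : ℤ) + 1, 1] : Site 2) ∈ discreteArc (oRect 1 2 0 1) (N : ℝ)⁻¹ (seam 1 j 0) ∧
      (![(N : ℤ) + 1, 1] : Site 2) ∈ discreteArc (oRect 1 2 0 1) (N : ℝ)⁻¹ (outer 1 0 ((1 : Fin 6), (0 : Fin (2 ^ 0)))) := by
  obtain ⟨⟨ht0, ht1⟩, -, e, -⟩ := invN_facts hN
  have htj : (N : ℝ)⁻¹ ≤ (2 ^ j)⁻¹ := inv_anti₀ (by positivity) (by exact_mod_cast hj)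
  refine tie_pair one_lt_two hN (s := 1) (by rw [e]) (by rw [e]; linarith) ((mem_seam0 (j := j)).2 ⟨rfl, ht0.le, htj⟩)
    (by rw [e, show (1 : ℝ) + (N : ℝ)⁻¹ - 1 = (N : ℝ)⁻¹ by ring, abs_of_pos ht0]) (by rw [mem_seam0]; norm_num)
    (mem_outer10.2 ⟨rfl, by show (1 : ℝ) ≤ (N : ℝ)⁻¹ * (((N : ℤ) + 1 : ℤ) : ℝ); rw [e]; linarith,
      by show (N : ℝ)⁻¹ * (((N : ℤ) + 1 : ℤ) : ℝ) ≤ 2; rw [e]; linarith⟩) (by rw [mem_outer10]; norm_num)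
/-- Tie vertex `P₄ = (2N-1,1)`: in the discrete arcs of the right side and of the bottom side of `Ω_R`. [folklore] -/
private theorem P4_mem {N : ℕ} (hN : 2 ≤ N) :
    (![2 * (N : ℤ) - 1, 1] : Site 2) ∈ discreteArc (oRect 1 2 0 1) (N : ℝ)⁻¹ (outer 1 0 ((2 : Fin 6), (0 : Fin (2 ^ 0)))) ∧
      (![2 * (N : ℤ) - 1, 1] : Site 2) ∈ discreteArc (oRect 1 2 0 1) (N : ℝ)⁻¹ (outer 1 0 ((1 : Fin 6), (0 : Fin (2 ^ 0)))) := by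
  obtain ⟨⟨ht0, ht1⟩, -, -, e⟩ := invN_facts hN
  refine tie_pair one_lt_two hN (s := 2) (by rw [e]; linarith) (by rw [e]) (mem_outer20.2 ⟨rfl, ht0.le, by show (N : ℝ)⁻¹ ≤ 1; linarith⟩)
    (by rw [e, show (2 : ℝ) - (N : ℝ)⁻¹ - 2 = -(N : ℝ)⁻¹ by ring, abs_neg, abs_of_pos ht0]) (by rw [mem_outer20]; norm_num)
    (mem_outer10.2 ⟨rfl, by show (1 : ℝ) ≤ (N : ℝ)⁻¹ * ((2 * (N : ℤ) - 1 : ℤ) : ℝ); rw [e]; linarith,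
      by show (N : ℝ)⁻¹ * ((2 * (N : ℤ) - 1 : ℤ) : ℝ) ≤ 2; rw [e]; linarith⟩) (by rw [mem_outer10]; norm_num)
/-- First visit to a column from above (mirror image of `exists_openConnIn_column`). [folklore] -/
private theorem exists_openConnIn_column_ge {ω : BondConfig (Site 2)} (hω : ω ⊆ (zdGraph 2).edgeSet)
    {S : Set (Site 2)} {x y : Site 2} (a : ℤ) (hx : a ≤ x 0) (hy : y 0 ≤ a) (h : ω ∈ openConnIn S x y) :
    ∃ z, z 0 = a ∧ ω ∈ openConnIn (S ∩ {z | a ≤ z 0}) x z := by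
  obtain ⟨hxS, hyS, ⟨p⟩⟩ := h
  suffices H : ∀ (u v : S) (p : ((openGraph ω).induce S).Walk u v), a ≤ (u : Site 2) 0 →
      (v : Site 2) 0 ≤ a → ∃ z, z 0 = a ∧ ω ∈ openConnIn (S ∩ {z | a ≤ z 0}) u z from H ⟨x, hxS⟩ ⟨y, hyS⟩ p hx hy
  intro u v p
  induction p with
  | nil => intro hu hv; rename_i u; exact ⟨u, le_antisymm hv hu, ⟨u.2, hu⟩, ⟨u.2, hu⟩, SimpleGraph.Reachable.refl _⟩
  | cons hadj p ih =>
    intro hu hv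
    rename_i u w v'
    rcases hu.eq_or_lt with hua | hua
    · exact ⟨u, hua.symm, ⟨u.2, hu⟩, ⟨u.2, hu⟩, SimpleGraph.Reachable.refl _⟩
    · have hadj' : (openGraph ω).Adj u w := hadj
      have hw : a ≤ (w : Site 2) 0 := by
        have hzd : (zdGraph 2).Adj (u : Site 2) (w : Site 2) := hω ((openGraph_adj _ _ _).1 hadj').1
        have := (zdGraph_adj_apply_le hzd 0).2; omega
      obtain ⟨z, hz, huS, hzS, hr⟩ := ih hw hv
      refine ⟨z, hz, ⟨u.2, hu⟩, hzS, SimpleGraph.Reachable.trans (SimpleGraph.Adj.reachable ?_) hr⟩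
      simpa [SimpleGraph.induce_adj] using hadj'
/-- An open connection inside a strip of rows `[r, r+n]`, from a point left of column `c` to a point
right of column `c + M`, contains a left-right crossing of `(c,r) + [0,M] × [0,n]`. [folklore] -/
private theorem mem_lrCrossingAt_of_openConnIn {ω : BondConfig (Site 2)} (hω : ω ⊆ (zdGraph 2).edgeSet)
    {S : Set (Site 2)} {x y : Site 2} {c r : ℤ} {M n : ℕ} (hS : S ⊆ {v | r ≤ v 1 ∧ v 1 ≤ r + n})
    (hx : x 0 ≤ c) (hy : c + M ≤ y 0) (h : ω ∈ openConnIn S x y) : ω ∈ lrCrossingAt ![c, r] M n := by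
  obtain ⟨z, hz0, hz⟩ := exists_openConnIn_column hω (c + M) (by omega) hy h
  rw [openConnIn_comm] at hz
  obtain ⟨w, hw0, hw⟩ := exists_openConnIn_column_ge hω c (by omega) hx hz
  rw [openConnIn_comm] at hw
  obtain ⟨hwT, hzT, -⟩ := id hw
  have hT : (S ∩ {v : Site 2 | v 0 ≤ c + M}) ∩ {v : Site 2 | c ≤ v 0} ⊆ (· + ![c, r]) '' (rectangle M n : Set (Site 2)) := by
    intro v hv
    rw [mem_image_rectangle_iff]
    have h1 := hS hv.1.1; have h2 := hv.1.2; have h3 := hv.2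
    simp only [mem_setOf_eq, Matrix.cons_val_zero, Matrix.cons_val_one] at h1 h2 h3 ⊢
    omega
  refine ⟨w, ⟨w - ![c, r], ?_, sub_add_cancel _ _⟩, z, ⟨z - ![c, r], ?_, sub_add_cancel _ _⟩, openConnIn_mono hT _ _ hw⟩
  · have h1 := hS hwT.1.1; have h3 := hwT.2
    simp only [Finset.mem_coe, leftSide, Finset.mem_filter, mem_rectangle_iff, Pi.sub_apply,
      Matrix.cons_val_zero, Matrix.cons_val_one, mem_setOf_eq] at h1 h3 ⊢
    omega
  · have h1 := hS hzT.1.1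
    simp only [Finset.mem_coe, rightSide, Finset.mem_filter, mem_rectangle_iff, Pi.sub_apply,
      Matrix.cons_val_zero, Matrix.cons_val_one, mem_setOf_eq] at h1 ⊢
    omega
/-- Integer coordinates of the mesh vertices of the domino at mesh `1/N`. [folklore] -/
private theorem int_bounds_of_mem {N : ℕ} (hN : 2 ≤ N) {v : Site 2} (hv : v ∈ meshVertices (oRect 0 2 0 1) (N : ℝ)⁻¹) :
    (0 < v 0 ∧ v 0 < (N : ℤ) * 2) ∧ (0 < v 1 ∧ v 1 < (N : ℤ)) := by
  have hN' : (0 : ℝ) < N := by exact_mod_cast (show 0 < N by omega)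
  obtain ⟨⟨h1, h2⟩, h3, h4⟩ := mem_meshVertices_oRect.1 hv
  have k1 := mul_pos hN' h1; have k2 := mul_lt_mul_of_pos_left h2 hN'
  have k3 := mul_pos hN' h3; have k4 := mul_lt_mul_of_pos_left h4 hN'
  rw [mul_inv_cancel_left₀ hN'.ne'] at k1 k2 k3 k4; rw [mul_one] at k4
  exact ⟨⟨by exact_mod_cast k1, by exact_mod_cast k2⟩, by exact_mod_cast k3, by exact_mod_cast k4⟩
/-- A vertex of the discrete arc of a vertical side `{re = s}` of the domino is no farther from it
than from the bottom and from the top: `|x₀/N - s| ≤ x₁/N` and `|x₀/N - s| ≤ 1 - x₁/N`. [folklore] -/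
private theorem arc_side_bounds {N : ℕ} {A : Set ℂ} {s : ℝ} (hA : ∀ z ∈ A, z.re = s) (hAne : A.Nonempty) {x : Site 2}
    (hx : x ∈ discreteArc (oRect 0 2 0 1) (N : ℝ)⁻¹ A) (hne : (N : ℝ)⁻¹ * x 0 ≠ s) :
    |(N : ℝ)⁻¹ * x 0 - s| ≤ (N : ℝ)⁻¹ * x 1 ∧ |(N : ℝ)⁻¹ * x 0 - s| ≤ 1 - (N : ℝ)⁻¹ * x 1 := by
  obtain ⟨hxB, hdist⟩ := hx
  obtain ⟨⟨h1, h2⟩, h3, h4⟩ := mem_meshVertices_oRect.1 (meshDomain_subset_meshVertices _ _ hxB.1)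
  have hlow : |(N : ℝ)⁻¹ * x 0 - s| ≤ infDist (meshPoint (N : ℝ)⁻¹ x) A :=
    le_infDist_of_forall' hAne fun z hz =>
      calc |(N : ℝ)⁻¹ * x 0 - s| = |(meshPoint (N : ℝ)⁻¹ x).re - z.re| := by rw [meshPoint_re, hA z hz]
        _ ≤ ‖meshPoint (N : ℝ)⁻¹ x - z‖ := abs_re_sub_le_norm_sub _ _
        _ = dist _ z := (dist_eq_norm _ _).symm
  have hF : ∀ t : ℝ, t = 0 ∨ t = 1 → (⟨(N : ℝ)⁻¹ * x 0, t⟩ : ℂ) ∈ frontier (oRect 0 2 0 1) \ A := fun t ht =>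
    ⟨mem_frontier_oRect two_pos zero_lt_one ⟨h1.le, h2.le⟩ ht, fun h => hne (hA _ h)⟩
  have hd : ∀ t : ℝ, dist (meshPoint (N : ℝ)⁻¹ x) ⟨(N : ℝ)⁻¹ * x 0, t⟩ = |(N : ℝ)⁻¹ * x 1 - t| := fun t => by
    rw [dist_of_re_eq (by simp [meshPoint_re]), Real.dist_eq, meshPoint_im]
  refine ⟨hlow.trans (hdist.trans ((infDist_le_dist_of_mem (hF 0 (Or.inl rfl))).trans_eq ?_)),
    hlow.trans (hdist.trans ((infDist_le_dist_of_mem (hF 1 (Or.inr rfl))).trans_eq ?_))⟩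
  · rw [hd, sub_zero, abs_of_pos h3]
  · rw [hd, abs_sub_comm, abs_of_pos (by linarith)]
/-- The support of a walk of `G ⊓ H` lies in any set containing the start and all `H`-neighbours. [folklore] -/
private theorem support_subset_of_walk {V : Type*} {G H : SimpleGraph V} {S : Set V} (hH : ∀ a b, H.Adj a b → b ∈ S)
    {x y : V} (p : (G ⊓ H).Walk x y) (hx : x ∈ S) : ∀ z ∈ p.support, z ∈ S := by
  induction p with
  | nil => simpa using hx
  | cons h p ih => simpa [hx] using ih (hH _ _ ((SimpleGraph.inf_adj _ _ _ _).1 h).2)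
/-- **Truth forces a long box crossing.** An open crossing of the discretised domino from the
discrete arc of its left side to that of its right side contains an open left-right crossing of
the translated lattice rectangle `(⌊N/2⌋, 1) + [0, N] × [0, N-2]` (`2x₀ ≤ N` and `2y₀ ≥ 3N` by
`arc_side_bounds`, then first/last column visits). [folklore] -/
private theorem truth_subset {N : ℕ} (hN : 2 ≤ N) :
    discreteCrossing (oRect 0 2 0 1) (N : ℝ)⁻¹ (outer 1 0 ((5 : Fin 6), (0 : Fin (2 ^ 0))))
        (outer 1 0 ((2 : Fin 6), (0 : Fin (2 ^ 0)))) ⊆ lrCrossingAt ![(N : ℤ) / 2, 1] N (N - 2) := by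
  rintro ω ⟨x, hx, y, hy, hr⟩
  have hN' : (0 : ℝ) < N := by exact_mod_cast (show 0 < N by omega)
  have ht0 : (0 : ℝ) < (N : ℝ)⁻¹ := inv_pos.2 hN'
  have hxV := meshDomain_subset_meshVertices _ _ hx.1.1
  obtain ⟨⟨hx0, -⟩, -⟩ := int_bounds_of_mem hN hxV
  obtain ⟨⟨-, hy0'⟩, -⟩ := int_bounds_of_mem hN (meshDomain_subset_meshVertices _ _ hy.1.1)
  have hx2 : 2 * x 0 ≤ (N : ℤ) := by
    have hpos : (0 : ℝ) < (N : ℝ)⁻¹ * x 0 := mul_pos ht0 (by exact_mod_cast hx0)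
    obtain ⟨ha, hb⟩ := arc_side_bounds (s := 0) (fun z hz => (mem_outer50.1 hz).1) ⟨⟨0, 0⟩, by rw [mem_outer50]; norm_num⟩ hx hpos.ne'
    rw [sub_zero, abs_of_pos hpos] at ha hb
    have key : (N : ℝ)⁻¹ * (2 * x 0) ≤ (N : ℝ)⁻¹ * N := by rw [inv_mul_cancel₀ hN'.ne']; linarith
    exact_mod_cast le_of_mul_le_mul_left key ht0
  have hy2 : 3 * (N : ℤ) ≤ 2 * y 0 := by
    have hlt : (N : ℝ)⁻¹ * y 0 < 2 := by
      have : ((y 0 : ℤ) : ℝ) < N * 2 := by exact_mod_cast hy0'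
      rw [inv_mul_lt_iff₀ hN']; linarith
    obtain ⟨ha, hb⟩ := arc_side_bounds (s := 2) (fun z hz => (mem_outer20.1 hz).1) ⟨⟨2, 0⟩, by rw [mem_outer20]; norm_num⟩ hy hlt.ne
    rw [abs_sub_comm, abs_of_pos (sub_pos.2 hlt)] at ha hb
    have key : (N : ℝ)⁻¹ * (3 * N) ≤ (N : ℝ)⁻¹ * (2 * y 0) := by rw [show (N : ℝ)⁻¹ * (3 * N) = 3 by field_simp]; linarith
    exact_mod_cast le_of_mul_le_mul_left key ht0
  -- the open path, as an open connection of the lattice configuration `ω ∩ E(ℤ²)` inside the mesh vertices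
  have hD := meshDomain_oRect 0 2 0 1 ht0
  obtain ⟨p⟩ := hr
  have hsupp : ∀ z ∈ p.support, z ∈ meshVertices (oRect 0 2 0 1) (N : ℝ)⁻¹ :=
    support_subset_of_walk (S := meshVertices (oRect 0 2 0 1) (N : ℝ)⁻¹)
      (fun a b hab => by rw [← hD]; exact (discreteDomainGraph_adj_iff.1 hab).2.2) p hxV
  have hedges : ∀ e ∈ p.edges, e ∈ ω ∩ (zdGraph 2).edgeSet := fun e he => by
    have h' := p.edges_subset_edgeSet he
    rw [SimpleGraph.edgeSet_inf] at h'
    exact ⟨edgeSet_openGraph_subset ω h'.1,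
      SimpleGraph.edgeSet_mono ((discreteDomainGraph_le_meshGraph _ _).trans (meshGraph_le_zdGraph _ _)) h'.2⟩
  have hrows : meshVertices (oRect 0 2 0 1) (N : ℝ)⁻¹ ⊆ {v : Site 2 | (1 : ℤ) ≤ v 1 ∧ v 1 ≤ 1 + ((N - 2 : ℕ) : ℤ)} :=
    fun v hv => by have := (int_bounds_of_mem hN hv).2; simp only [mem_setOf_eq]; omega
  exact isUpperSet_lrCrossingAt _ _ _ (inter_subset_left (s := ω) (t := (zdGraph 2).edgeSet))
    (mem_lrCrossingAt_of_openConnIn inter_subset_right hrows (c := (N : ℤ) / 2) (M := N) (n := N - 2)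
      (by omega) (by omega) (mem_openConnIn_of_walk p hsupp hedges))
/-- **The witness.** At mesh `1/N` with `N ≥ max (2, 2^j)` the error event has probability at least
`1/2`: glued(left, right) holds for every `ω` through the tie vertices `P₁ … P₄`, so the event
contains the complement of the long-way box crossing of `truth_subset`, whose probability is at
most `h(N-1, N-2) = 1/2` (Grimmett 1999, Lemma 11.21). [folklore] -/
private theorem half_le_real_Err {N j : ℕ} (hN : 2 ≤ N) (hj : 2 ^ j ≤ N) :
    (1 / 2 : ℝ) ≤ (bondPercolation (zdGraph 2) half).real (Err 1 0 j (N : ℝ)⁻¹) := by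
  have hsub : (lrCrossingAt ![(N : ℤ) / 2, 1] N (N - 2))ᶜ ⊆ Err 1 0 j (N : ℝ)⁻¹ := by
    intro ω hω
    simp only [Err, mem_setOf_eq]
    refine ⟨((5 : Fin 6), (0 : Fin (2 ^ 0))), ((2 : Fin 6), (0 : Fin (2 ^ 0))), fun hiff => hω ?_⟩
    have hglued := hiff.1
    rw [dom_one.1, dom_one.2.1, dom_one.2.2] at hglued
    have notL1 : ¬ ((1 : Fin 6) = 0 ∨ (1 : Fin 6) = 4 ∨ (1 : Fin 6) = 5) := by decide
    have notL2 : ¬ ((2 : Fin 6) = 0 ∨ (2 : Fin 6) = 4 ∨ (2 : Fin 6) = 5) := by decide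
    have link : ∀ {Ω' A B : Set ℂ} {P : Site 2}, P ∈ discreteArc Ω' (N : ℝ)⁻¹ A → P ∈ discreteArc Ω' (N : ℝ)⁻¹ B →
        ω ∈ discreteCrossing Ω' (N : ℝ)⁻¹ A B := fun hA hB => ⟨_, hA, _, hB, SimpleGraph.Reachable.refl _⟩
    refine truth_subset hN (hglued ?_)
    refine Relation.EqvGen.trans _ (Sum.inl ((0 : Fin 6), (0 : Fin (2 ^ 0)))) _
      (Relation.EqvGen.rel _ _ (Or.inl ⟨Or.inr (Or.inr rfl), Or.inl rfl, link (P1_mem hN).1 (P1_mem hN).2⟩)) ?_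
    refine Relation.EqvGen.trans _ (Sum.inr (0 : Fin (2 ^ j))) _
      (Relation.EqvGen.rel _ _ (Or.inl ⟨Or.inl rfl, trivial, link (P2_mem hN hj).2 (P2_mem hN hj).1⟩)) ?_
    refine Relation.EqvGen.trans _ (Sum.inl ((1 : Fin 6), (0 : Fin (2 ^ 0)))) _
      (Relation.EqvGen.rel _ _ (Or.inr ⟨trivial, notL1, link (P3_mem hN hj).1 (P3_mem hN hj).2⟩)) ?_
    exact Relation.EqvGen.rel _ _ (Or.inr ⟨notL1, notL2, link (P4_mem hN).2 (P4_mem hN).1⟩)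
  have h1 : (bondPercolation (zdGraph 2) half).real (lrCrossingAt ![(N : ℤ) / 2, 1] N (N - 2))ᶜ = 1 - crossingProb half N (N - 2) := by
    rw [measureReal_compl (measurableSet_lrCrossingAt _ _ _), probReal_univ, bondPercolation_real_lrCrossingAt]
  have h2 : crossingProb half N (N - 2) ≤ 1 / 2 := by
    have h3 := crossingProb_half_succ_self_holds (N - 2)
    rw [show N - 2 + 1 = N - 1 by omega] at h3
    exact (crossingProb_anti_left half (show N - 1 ≤ N by omega) (N - 2)).trans h3.le
  calc (1 / 2 : ℝ) ≤ 1 - crossingProb half N (N - 2) := by linarith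
    _ = _ := h1.symm
    _ ≤ _ := measureReal_mono hsub

/-- Refutes `CardyGluingRDE.JunctionShadowing` (stmt-CriticalPhenomena-8581) [refuted-misstated]:
the one-seam shadowing bound `P_{1/2}(Err δ₀ r j u) ≤ C·2^{-ε(j-r)}` for all small meshes is false,
because the G02 discrete arcs (`discreteArc`, comparison `≤`) of adjacent nodes SHARE their tie
vertices and `discreteCrossing` is reflexive there. Witness: `δ₀ = 1`, `r = 0`, any `j` with
`C·2^{-εj} < 1/2`, meshes `u = 1/N`, `N > max (2, 2^j, 1/δ₁)`: the corner vertices `(1,1)`,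
`(N-1,1)`, `(N+1,1)`, `(2N-1,1)` glue left side ~ bottom of `Ω_L` ~ seam arc 0 ~ bottom of `Ω_R` ~
right side for every `ω`, whereas the truth "left side ↔ right side in the domino `Ω_{1/N}`" lies in
the long-way crossing `lrCrossingAt (⌊N/2⌋,1) N (N-2)` (`truth_subset`) of probability
`≤ h(N-1,N-2) = 1/2` (`crossingProb_anti_left`, `crossingProb_half_succ_self_holds`), so
`P(Err) ≥ 1/2 > C·2^{-εj}` (`half_le_real_Err`). Repaired statement C′ (believed true; the planner's
intended lemma): the same statement with STRICT discrete arcs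
`{x ∈ meshBoundary Ω u | infDist x A < infDist x (∂Ω ∖ A)}` replacing `discreteArc` inside both
the glued relation and the truth event (equivalently: remove from every node the vertices it shares
with a neighbouring node); the witness misses C′ (a tie vertex lies in no strict arc), and the
remaining lattice-scale defects near the seam endpoints and at commensurable heights cost
boundary/four-arm events from scale `u`, vanishing as `u → 0`. [folklore] -/
theorem CardyGluingRDEJunctionShadowing_refuted :
    ¬ Summit.CriticalPhenomena.CardyFormulaZ2.Theses.CardyGluingRDE.JunctionShadowing := by
  rw [iff_mirror]
  rintro ⟨ε, hε, h⟩
  obtain ⟨C, hC, h⟩ := h 0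
  obtain ⟨j, hj⟩ := exists_pow_lt_of_lt_one (show (0 : ℝ) < 1 / (2 * C) by positivity)
    (Real.rpow_lt_one_of_one_lt_of_neg one_lt_two (neg_neg_of_pos hε))
  obtain ⟨δ₁, hδ₁, h⟩ := h j (Nat.zero_le j) 1 one_pos
  obtain ⟨N, hN⟩ := exists_nat_gt (max (max (2 : ℝ) (2 ^ j)) δ₁⁻¹)
  have hN2 : 2 ≤ N := by exact_mod_cast ((le_max_left _ _).trans (le_max_left _ _) |>.trans hN.le)
  have hNj : 2 ^ j ≤ N := by exact_mod_cast ((le_max_right _ _).trans (le_max_left _ _) |>.trans hN.le)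
  have hNpos : (0 : ℝ) < N := by exact_mod_cast (show 0 < N by omega)
  have key := h (N : ℝ)⁻¹ (inv_pos.2 hNpos) (inv_lt_of_inv_lt₀ hδ₁ ((le_max_right _ _).trans_lt hN))
  have low := half_le_real_Err hN2 hNj
  have hsmall : C * (2 : ℝ) ^ (-(ε * ((j : ℝ) - ((0 : ℕ) : ℝ)))) < 1 / 2 := by
    rw [Nat.cast_zero, sub_zero, ← neg_mul, Real.rpow_mul (by norm_num), Real.rpow_natCast]
    calc C * ((2 : ℝ) ^ (-ε)) ^ j < C * (1 / (2 * C)) := mul_lt_mul_of_pos_left hj hC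
      _ = 1 / 2 := by field_simp
  linarith

end Summit.CriticalPhenomena.CardyFormulaZ2.Theorems
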